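import Literature.AlgebraicGeometry.HodgeTheory.KunnethSpanning
import Literature.AlgebraicGeometry.HodgeTheory.GysinBaseChange
import HarnessLib

/-!
# Künneth formula for the complex points of a product of smooth projective varieties, spanning
# half — discharge of the named fact `kunneth_span_crossProducts`

Topic `Literature/AlgebraicGeometry/HodgeTheory`. Companion (proof file) of `KunnethSpanning.lean`,
whose named fact `kunneth_span_crossProducts` (Hatcher, *Algebraic Topology*, Thm. 3.15 / §3.B
Thm. 3B.6 with field coefficients, spelled with the tree's cup product and pull-backs along
`fst`, `snd`) was relocated there from a Summits proposal on 2026-08-16. The statement is, symbol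
for symbol, the universal closure of the tree's PROVED theorem
`Literature.AlgebraicGeometry.HodgeTheory.kunnethSpan_complexBetti` (`GysinBaseChange.lean`: the
Künneth formula `LerayHirsch.kunneth_mem_span_of_field` for the compact Hausdorff manifolds `Y(ℂ)`,
`Z(ℂ)`, obtained from the tree's Leray–Hirsch engine, transported along the homeomorphism
`(Y ⊗ Z)(ℂ) ≃ₜ Y(ℂ) × Z(ℂ)`, `AlgPoints.isHomeomorph_prodEquiv_holds`). This file records the
discharge `kunneth_span_crossProducts_holds`; nothing else.

## References

* [HatcherAT2002] A. Hatcher, Algebraic Topology, CUP 2002, §3.2 Thm. 3.15–3.16, §3.B Thm. 3B.6.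
-/

namespace Literature.AlgebraicGeometry.HodgeTheory

/-- **The Künneth spanning property holds** (discharge of the named fact
`kunneth_span_crossProducts`): for smooth projective complex `Y`, `Z`, every class of
`Hᵏ((Y ⊗ Z)(ℂ); ℂ)` is a `ℂ`-linear combination of cross products `fst^* b ∪ snd^* w` — the tree's
theorem `kunnethSpan_complexBetti`, universally closed.
[cite: HatcherAT2002, §3.2 Thm. 3.15 and §3.B Thm. 3B.6] -/
theorem kunneth_span_crossProducts_holds : kunneth_span_crossProducts :=
  fun _ _ _ _ hY hZ k z => kunnethSpan_complexBetti hY hZ k z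

end Literature.AlgebraicGeometry.HodgeTheory
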